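import Summits.QuantumFields.YangMills.Theorems.BalabanUVNodesN11FirstStepQuadSlot

/-!
# DAG node N11 — EVERY 𝐓-LAW OF THE RECORD HOLDS MODULO SUPPORTS: the residual slot `Zh` is indexed by the history LENGTH, so at every step `k` a switch on `ζ_k(Ω_{k+1}ᶜ)` and a dial on
# `quad_k`, both reading only the new field `V_{k+1}`, pass through the newest generation of `𝐓_{k+1}(s)` (which acts outermost, (3.24)) without touching the older ones — hence, next
# to every `θ` and inside K1⁹'s hypothesis class, `TLaw₁₃CoPH θ′ p k` for EVERY `k` from per-child SUPPORT conditions and the term laws alone (count-neutral, LOCATED; nothing of Bałaban)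

HEADER — WORK-UNIT METADATA.  Cell `pub-ymgap`, YM-PLAN Track A (HUMAN RULING D-0062), seat `pub-ymgap-dag-n11-d` (g34; N11 [B14], s2), route `BalabanUVNodes`, item K1⁹ =
stmt-QuantumFields-27364 (helper lane, `--kind proof --supports 27364 --as helper`, count-neutral).  [III] = [Balaban1988Convergent], [IV] = [Balaban1989LargeFieldI].  Over this seat's
`…N11FirstStepQuadSlot` (g34: the first step; ★ `genOp_genDataOfRecord_mul` — multipliers reading `(ω (j+1)).1` pass through `𝐓^{(j)}`), `…TopPairQuadSlot` ∕ `…K1Hypotheses` (g34: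
`slotsTOfRecord_nonneg_of_provisos₁₃CoPH`, the `sameR` transports), 11a `Node00/TkOfRecord` (`tkBranchOfRecord_succ ∕ _zero`, `TkOfRecord_apply`, `genDataOfRecord`), RECORD 13 v1.7 `H`
(`Stage13HParams.Zh p n Ω Λ` — the residual serving the histories OF LENGTH `n`; `WtOfRecord₁₃H`, `tLaw₁₃CoPH_iff`).

WHY ∕ WHAT.  The companion settles the first step (`k = 0`); here every step.  §1 `genDataOfRecord_congr` · `tkBranchOfRecord_congr_below` (the branch operator `𝐓_k(s, S)` reads the
generations `j < k` only) · ★★ `tkOfRecord_succ_mul` · ★★ `sect2Slot_succ_mul` (weight data agreeing below generation `k` and differing at generation `k` by multipliers `φ₁(V_{k+1})`,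
`φ₂(V_{k+1})` multiply `𝐓_{k+1}(s)[·] Φ (V_{k+1})` by `φ₁φ₂`).  §2 ★★★ `slotsT_succ_eq_sect2Slot_of_switch_dial` (switch `𝟙{0 < (𝐓ρ_k)(s) ∧ 0 < J}` on `ζ_k(Ω_{k+1}ᶜ)`, dial `e^{−log(J∕𝐓ρ_k(s))}`
on the generation-`k` A-weights, `J` = `θ`'s own new side with the generation-`k` residual factor set to `1` ⇒ old side `=` new side wherever `0 < (𝐓ρ_k)(s)(V) → 0 < J(V)`).  §3: the re-pin at
the top generation of EVERY history length (`ζ0_{n−1}(Y)(ω) = 𝟙{Y = R_{p,n,Ω,Λ}((ω n).1)}`, `quad_{n−1} + c_{p,n,Ω,Λ}((ω n).1)`; everything below unchanged) is inhabited next to every `θ` with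
`zhLocal` ∕ `zhLaws` ∕ `ZhUnity` transferred (★ `zhLocal_of_repinTop` …) and ★★★★★ `exists_zh_allSteps_tLaw_of_supports`: for every run `p` and EVERY `k`, (i) `0 ≤ 𝐓ρ_k(s)` ∧ (ii) per child
of length `k+1`, a.e. on the `χ_{k+1}(s)`-support, «`0 < (𝐓ρ_k)(s) → 0 < J_p(s)`» ∧ (iii) `Sect2.LawsT … k` for the prescribed terms ⟹ `TLaw₁₃CoPH θ′ p k`.  §4 ★★★★★
`exists_zh_allSteps_tLaw_of_supports_of_hypotheses`: the same INSIDE K1⁹'s hypothesis class ((i) discharged by `zetaUnity`∕`zetaAbs`).  READING (type owners def-T ∕ K0b ∕ RR-2): absent a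
law tying `quad` to the fluctuation variables, the whole 𝐓-side of the record — [III] Thm 1 at every step — asks of a K1⁹ witness only SUPPORT conditions and term laws; its quantitative
content enters the record only through the pins of `quad` (C2) and `ζ0` (K0b).  RR-2's first-hand reading (bus 2026-08-29T15:20:20Z) confirms the premise and costs the row (q1).

HONEST FRAMING.  A READING on the tree's own rows and objects (count-neutral, LOCATED): nothing of Bałaban asserted or refuted — the switch is NOT print's (3.2) region map, the dial is NOT
[I]'s `⟨A, 𝒬A⟩`; the support conditions (ii) are NOT claimed at any `θ` (they read `θ`'s `quad` through the A-integrals of `J`); K1⁹'s `∃θ` NOT advanced and NOT refuted (the 𝐒-laws, the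
𝐑-steps [IV] (0.2)–(0.3), the term laws and the consequent's faces are untouched); no `Stage13HParams` of record constructed or modified (§3–§4 are anonymous-constructor inhabitations next to
an arbitrary `θ`); N11 NOT discharged; K1⁹ NOT closed; no registered stub touched; counts unmoved (typed 28∕28 · discharged 8∕27).  One finite four-torus programme at fixed `ε = L^{−K}`; NOT ℝ⁴,
NOT OS, NOT a mass gap, NOT Clay.  No `sorry`, `axiom`, `def`, `instance`, `notation`.  Sources (SHAPE only): [III] Thm 1 p.262, remark p.262, (2.18) p.257, (2.20)–(2.23) p.258, (3.2)–(3.9)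
pp.265–266, p.267, (3.16)–(3.21) pp.268–269, (3.23)–(3.25) p.270, Def. p.279; [IV] (0.2)–(0.3) p.176.
-/

noncomputable section

open MeasureTheory
open scoped BigOperators Matrix.Norms.L2Operator

namespace Summit.QuantumFields.YangMills.Theorems.BalabanUVNodesN11AllStepsQuadSlot

open Literature.MathematicalPhysics.QuantumFieldTheory.Balaban1983to89 T4Continuum Node00 Node00.Tk B14.Eq218Concrete B14.Sect3Decomp
open BalabanUVNodesN11TopPairLocalResidual (WtOfRecord₁₃H_ζ_eq_ζ0)
open BalabanUVNodesN11TopPairQuadSlot (slotsTOfRecord_nonneg_of_provisos₁₃CoPH)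
open BalabanUVNodesN11TopPairQuadSlotK1Hypotheses (provisos₁₃SepCoPH_of_sameR slotsNondegenerate₁₃_of_sameR admissible_of_sameR)
open BalabanUVNodesN11FirstStepQuadSlot (genOp_genDataOfRecord_mul)

variable {F : T4Family} {N : ℕ} [NeZero N]

/-! ## §1. The branch operator below generation `k` does not read generation `k`; multipliers at generation `k` reading only `V_{k+1}` pass through `𝐓_{k+1}(s)` -/

section Generations

variable (ν : Stage7Numerics) (M : ℕ) (g : ℕ → ℝ) (K : ℕ)

/-- Generation data of record read the weight datum ONLY through `ζ_j(Ω_{j+1}ᶜ)` and the generation-`j` A-weight `w_j(Λ_{j+1}, Λ_{j+1}ᶜ ∩ Ω_{j+1}, S_{j+1})`: two weight data agreeing there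
give the same generation. [cite: Balaban1988Convergent, (2.21) p.258, (3.23) p.270 (bookkeeping)] -/
theorem genDataOfRecord_congr {W W' : TkWeights F N (FluctV N) K} {n : ℕ} (s : SeqOfRecord F ν M g K n) (S : ℕ → Set (Site (F.P K) 0)) (j : ℕ)
    {hdec : DecidableEq (PBond (F.P K) j)} (hζ : W'.ζ j (s.Ω (j + 1))ᶜ = W.ζ j (s.Ω (j + 1))ᶜ)
    (hw : W'.w j (s.Λ (j + 1)) ((s.Λ (j + 1))ᶜ ∩ s.Ω (j + 1)) (S (j + 1)) = W.w j (s.Λ (j + 1)) ((s.Λ (j + 1))ᶜ ∩ s.Ω (j + 1)) (S (j + 1))) :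
    genDataOfRecord F N (FluctV N) ν M g K W' s S j = genDataOfRecord F N (FluctV N) ν M g K W s S j := by
  unfold genDataOfRecord
  rw [hζ, hw]

/-- **THE BRANCH OPERATOR `𝐓_k(s, S)` READS THE GENERATIONS `j < k` ONLY**: weight data agreeing at those generations give the same `𝐓_k(s, S)`. [cite: Balaban1988Convergent, (2.20) p.258, (3.24) p.270 (bookkeeping)] -/
theorem tkBranchOfRecord_congr_below {W W' : TkWeights F N (FluctV N) K} {n : ℕ} (s : SeqOfRecord F ν M g K n) (S : ℕ → Set (Site (F.P K) 0)) (k : ℕ)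
    (hζ : ∀ j, j < k → W'.ζ j (s.Ω (j + 1))ᶜ = W.ζ j (s.Ω (j + 1))ᶜ)
    (hw : ∀ j, j < k → W'.w j (s.Λ (j + 1)) ((s.Λ (j + 1))ᶜ ∩ s.Ω (j + 1)) (S (j + 1)) = W.w j (s.Λ (j + 1)) ((s.Λ (j + 1))ᶜ ∩ s.Ω (j + 1)) (S (j + 1)))
    (Φ : MultiCfg (F.P K) (SU N) (FluctV N) → ℝ) :
    tkBranchOfRecord F N (FluctV N) ν M g K W' s S k Φ = tkBranchOfRecord F N (FluctV N) ν M g K W s S k Φ := by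
  induction k with
  | zero => rfl
  | succ k ih =>
    rw [tkBranchOfRecord_succ, tkBranchOfRecord_succ, ih (fun j hj => hζ j (Nat.lt_succ_of_lt hj)) (fun j hj => hw j (Nat.lt_succ_of_lt hj)),
      genDataOfRecord_congr ν M g K s S k (hζ k (Nat.lt_succ_self k)) (hw k (Nat.lt_succ_self k))]

/-- ★★ **MULTIPLIERS AT THE TOP GENERATION PASS THROUGH `𝐓_{k+1}(s)`**: weight data agreeing with `W` below generation `k` and differing at generation `k` by multipliers `φ₁(V_{k+1})` (on
`ζ_k(Ω_{k+1}ᶜ)`) and `φ₂(V_{k+1})` (on the A-weights `w_k(Λ_{k+1}, ·, ·)`) give `𝐓_{k+1}(s)[W′] Φ (V_{k+1}) = φ₁(V_{k+1})·φ₂(V_{k+1})·𝐓_{k+1}(s)[W] Φ (V_{k+1})` — the newest generation acts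
OUTERMOST ((3.24)) and is read at `base_{k+1}(V_{k+1})`. [cite: Balaban1988Convergent, (2.18) p.257, (2.20)–(2.21) p.258, (3.24) p.270 (bookkeeping)] -/
theorem tkOfRecord_succ_mul {W W' : TkWeights F N (FluctV N) K} {k : ℕ} (s : SeqOfRecord F ν M g K (k + 1)) (φ₁ φ₂ : GaugeField (F.P K) (k + 1) (SU N) → ℝ)
    (hζlt : ∀ j, j < k → W'.ζ j (s.Ω (j + 1))ᶜ = W.ζ j (s.Ω (j + 1))ᶜ)
    (hwlt : ∀ j, j < k → ∀ S₁, W'.w j (s.Λ (j + 1)) ((s.Λ (j + 1))ᶜ ∩ s.Ω (j + 1)) S₁ = W.w j (s.Λ (j + 1)) ((s.Λ (j + 1))ᶜ ∩ s.Ω (j + 1)) S₁)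
    (hζ : ∀ ω, W'.ζ k (s.Ω (k + 1))ᶜ ω = φ₁ (ω (k + 1)).1 * W.ζ k (s.Ω (k + 1))ᶜ ω)
    (hw : ∀ S₁ ω, W'.w k (s.Λ (k + 1)) ((s.Λ (k + 1))ᶜ ∩ s.Ω (k + 1)) S₁ ω = φ₂ (ω (k + 1)).1 * W.w k (s.Λ (k + 1)) ((s.Λ (k + 1))ᶜ ∩ s.Ω (k + 1)) S₁ ω)
    (Φ : SFluct (F.P K) (FluctV N) → B15DeterminingSets.MSField (F.P K) (SU N) → ℝ) (V : GaugeField (F.P K) (k + 1) (SU N)) :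
    TkOfRecord F N (FluctV N) ν M g K W' (k + 1) s Φ V = φ₁ V * φ₂ V * TkOfRecord F N (FluctV N) ν M g K W (k + 1) s Φ V := by
  rw [TkOfRecord_apply, TkOfRecord_apply, Finset.mul_sum]
  refine Finset.sum_congr rfl fun S _ => ?_
  rw [tkBranchOfRecord_succ, tkBranchOfRecord_succ, tkBranchOfRecord_congr_below ν M g K s S k hζlt (fun j hj => hwlt j hj (S (j + 1))),
    genOp_genDataOfRecord_mul ν M g K s S k φ₁ φ₂ hζ (hw (S (k + 1))) _ (baseCfg (k + 1) V)]
  have hb : ((baseCfg (V := FluctV N) (k + 1) V) (k + 1)).1 = V := funext fun b => baseCfg_fst_self (V := FluctV N) (k + 1) V b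
  rw [hb]

/-- ★★ **… HENCE FOR THE NEW SIDE OF EVERY CHILD OF EVERY STEP**: `sect2Slot(W′, s, t, E′, U)(V_{k+1}) = φ₁(V_{k+1})·φ₂(V_{k+1})·sect2Slot(W, s, t, E′, U)(V_{k+1})`.
[cite: Balaban1988Convergent, (2.18) p.257, (2.21)–(2.23) p.258, (3.23)–(3.25) p.270 (bookkeeping)] -/
theorem sect2Slot_succ_mul {𝔸 : Type*} [NormedRing 𝔸] [NormedAlgebra ℂ 𝔸] [CompleteSpace 𝔸] {W W' : TkWeights F N (FluctV N) K} {k : ℕ}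
    (s : SeqOfRecord F ν M g K (k + 1)) (φ₁ φ₂ : GaugeField (F.P K) (k + 1) (SU N) → ℝ)
    (hζlt : ∀ j, j < k → W'.ζ j (s.Ω (j + 1))ᶜ = W.ζ j (s.Ω (j + 1))ᶜ)
    (hwlt : ∀ j, j < k → ∀ S₁, W'.w j (s.Λ (j + 1)) ((s.Λ (j + 1))ᶜ ∩ s.Ω (j + 1)) S₁ = W.w j (s.Λ (j + 1)) ((s.Λ (j + 1))ᶜ ∩ s.Ω (j + 1)) S₁)
    (hζ : ∀ ω, W'.ζ k (s.Ω (k + 1))ᶜ ω = φ₁ (ω (k + 1)).1 * W.ζ k (s.Ω (k + 1))ᶜ ω)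
    (hw : ∀ S₁ ω, W'.w k (s.Λ (k + 1)) ((s.Λ (k + 1))ᶜ ∩ s.Ω (k + 1)) S₁ ω = φ₂ (ω (k + 1)).1 * W.w k (s.Λ (k + 1)) ((s.Λ (k + 1))ᶜ ∩ s.Ω (k + 1)) S₁ ω)
    (Sg : Sect2.Setting 𝔸 (SU N)) (Rz : Sect2.Residual (F.P K) 𝔸) (t : Sect2.TermValues (F.P K) 𝔸 (FluctV N) M) (E' : ℝ) (U : BgMap F N K)
    (V : GaugeField (F.P K) (k + 1) (SU N)) :
    sect2Slot F N (FluctV N) K Sg Rz W' s t E' U V = φ₁ V * φ₂ V * sect2Slot F N (FluctV N) K Sg Rz W s t E' U V :=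
  tkOfRecord_succ_mul ν M g K s φ₁ φ₂ hζlt hwlt hζ hw _ V

end Generations

/-! ## §2. At the record, step `k → k+1`, child `s = ({Ω_i}, {Λ_i})_{i ≤ k+1}`: the switch on `ζ_k(Ω_{k+1}ᶜ)` and the dial on `quad_k` serve the child wherever its supports allow -/

section Record

variable (θ : Stage13HParams F N) (p : B12.RunParams)

/-- ★★★ **THE SWITCH-AND-DIAL IDENTITY AT AN ARBITRARY CHILD OF AN ARBITRARY STEP** (any terms; `T` = the old side `(𝐓ρ_k)(s)`, `J` = `θ`'s own new side at `s` with the generation-`k`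
residual factor set to `1`): weight data `W′` agreeing with `θ`'s below generation `k`, with generation-`k` `ζ`-factor on `Ω_{k+1}ᶜ` equal to `𝟙{0 < T(V_{k+1}) ∧ 0 < J(V_{k+1})}` and
generation-`k` A-weights `e^{−½c(V_{k+1})}` times `θ`'s, `c = 2·log(J∕T)` where both are positive, give OLD SIDE = NEW SIDE at every `V` with `0 ≤ T(V)` and `0 < T(V) → 0 < J(V)`.
[cite: Balaban1988Convergent, (2.18) p.257, (2.21)–(2.23) p.258, (3.23)–(3.25) p.270 (bookkeeping)] -/
theorem slotsT_succ_eq_sect2Slot_of_switch_dial {k : ℕ} (s : SeqOfRecord F θ.ν θ.τ9.M (gOfRecord₁₃ F N θ.toStage13Params p) p.K (k + 1))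
    (u₁ : Sect2.TermValues (F.P p.K) (MatA N) (FluctV N) θ.τ9.M) (e₁ : ℝ) (W' : TkWeights F N (FluctV N) p.K) (c : GaugeField (F.P p.K) (k + 1) (SU N) → ℝ)
    (hζlt : ∀ j, j < k → W'.ζ j (s.Ω (j + 1))ᶜ = (WtOfRecord₁₃H F N θ p s).ζ j (s.Ω (j + 1))ᶜ)
    (hwlt : ∀ j, j < k → ∀ S₁, W'.w j (s.Λ (j + 1)) ((s.Λ (j + 1))ᶜ ∩ s.Ω (j + 1)) S₁ = (WtOfRecord₁₃H F N θ p s).w j (s.Λ (j + 1)) ((s.Λ (j + 1))ᶜ ∩ s.Ω (j + 1)) S₁)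
    (hζ : ∀ ω, W'.ζ k (s.Ω (k + 1))ᶜ ω =
      Set.indicator {V | 0 < slotsTOfRecord F N θ.ν θ.τ9 (EOfRecord₁₃ F N θ.toStage13Params) (wOfRecord₉ F N θ.toStage9Params) θ.ppSel p
          (gOfRecord₁₃ F N θ.toStage13Params p) (k + 1) s V ∧
        0 < sect2Slot F N (FluctV N) p.K (settingOfRecord₁₃ F N θ.toStage13Params p) (θ.rzAt p s)
          { WtOfRecord₁₃H F N θ p s with ζ := fun j Y ω => if j = k then 1 else (WtOfRecord₁₃H F N θ p s).ζ j Y ω } s u₁ e₁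
          (UbgOfRecord₁₃CoP F N θ.toStage13Params p (k + 1) s) V} (1 : GaugeField (F.P p.K) (k + 1) (SU N) → ℝ) (ω (k + 1)).1)
    (hw : ∀ S₁ ω, W'.w k (s.Λ (k + 1)) ((s.Λ (k + 1))ᶜ ∩ s.Ω (k + 1)) S₁ ω =
      Real.exp (-(1 / 2 : ℝ) * c (ω (k + 1)).1) * (WtOfRecord₁₃H F N θ p s).w k (s.Λ (k + 1)) ((s.Λ (k + 1))ᶜ ∩ s.Ω (k + 1)) S₁ ω)
    (hc : ∀ V, 0 < slotsTOfRecord F N θ.ν θ.τ9 (EOfRecord₁₃ F N θ.toStage13Params) (wOfRecord₉ F N θ.toStage9Params) θ.ppSel p (gOfRecord₁₃ F N θ.toStage13Params p) (k + 1) s V →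
      0 < sect2Slot F N (FluctV N) p.K (settingOfRecord₁₃ F N θ.toStage13Params p) (θ.rzAt p s)
          { WtOfRecord₁₃H F N θ p s with ζ := fun j Y ω => if j = k then 1 else (WtOfRecord₁₃H F N θ p s).ζ j Y ω } s u₁ e₁
          (UbgOfRecord₁₃CoP F N θ.toStage13Params p (k + 1) s) V →
      c V = 2 * Real.log (sect2Slot F N (FluctV N) p.K (settingOfRecord₁₃ F N θ.toStage13Params p) (θ.rzAt p s)
          { WtOfRecord₁₃H F N θ p s with ζ := fun j Y ω => if j = k then 1 else (WtOfRecord₁₃H F N θ p s).ζ j Y ω } s u₁ e₁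
          (UbgOfRecord₁₃CoP F N θ.toStage13Params p (k + 1) s) V /
        slotsTOfRecord F N θ.ν θ.τ9 (EOfRecord₁₃ F N θ.toStage13Params) (wOfRecord₉ F N θ.toStage9Params) θ.ppSel p (gOfRecord₁₃ F N θ.toStage13Params p) (k + 1) s V))
    (V : GaugeField (F.P p.K) (k + 1) (SU N))
    (h0 : 0 ≤ slotsTOfRecord F N θ.ν θ.τ9 (EOfRecord₁₃ F N θ.toStage13Params) (wOfRecord₉ F N θ.toStage9Params) θ.ppSel p (gOfRecord₁₃ F N θ.toStage13Params p) (k + 1) s V)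
    (hTJ : 0 < slotsTOfRecord F N θ.ν θ.τ9 (EOfRecord₁₃ F N θ.toStage13Params) (wOfRecord₉ F N θ.toStage9Params) θ.ppSel p (gOfRecord₁₃ F N θ.toStage13Params p) (k + 1) s V →
      0 < sect2Slot F N (FluctV N) p.K (settingOfRecord₁₃ F N θ.toStage13Params p) (θ.rzAt p s)
          { WtOfRecord₁₃H F N θ p s with ζ := fun j Y ω => if j = k then 1 else (WtOfRecord₁₃H F N θ p s).ζ j Y ω } s u₁ e₁
          (UbgOfRecord₁₃CoP F N θ.toStage13Params p (k + 1) s) V) :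
    slotsTOfRecord F N θ.ν θ.τ9 (EOfRecord₁₃ F N θ.toStage13Params) (wOfRecord₉ F N θ.toStage9Params) θ.ppSel p (gOfRecord₁₃ F N θ.toStage13Params p) (k + 1) s V =
      sect2Slot F N (FluctV N) p.K (settingOfRecord₁₃ F N θ.toStage13Params p) (θ.rzAt p s) W' s u₁ e₁ (UbgOfRecord₁₃CoP F N θ.toStage13Params p (k + 1) s) V := by
  set T := slotsTOfRecord F N θ.ν θ.τ9 (EOfRecord₁₃ F N θ.toStage13Params) (wOfRecord₉ F N θ.toStage9Params) θ.ppSel p (gOfRecord₁₃ F N θ.toStage13Params p) (k + 1) s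
    with hT
  set Wr : TkWeights F N (FluctV N) p.K := { WtOfRecord₁₃H F N θ p s with ζ := fun j Y ω => if j = k then 1 else (WtOfRecord₁₃H F N θ p s).ζ j Y ω } with hWr
  set J := sect2Slot F N (FluctV N) p.K (settingOfRecord₁₃ F N θ.toStage13Params p) (θ.rzAt p s) Wr s u₁ e₁ (UbgOfRecord₁₃CoP F N θ.toStage13Params p (k + 1) s) with hJ
  have key := sect2Slot_succ_mul θ.ν θ.τ9.M (gOfRecord₁₃ F N θ.toStage13Params p) p.K s (W := Wr) (W' := W')
    (fun V₁ => Set.indicator {V | 0 < T V ∧ 0 < J V} (1 : GaugeField (F.P p.K) (k + 1) (SU N) → ℝ) V₁) (fun V₁ => Real.exp (-(1 / 2 : ℝ) * c V₁))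
    (fun j hj => by rw [hζlt j hj]; exact (funext fun ω => if_neg (Nat.ne_of_lt hj)).symm) (fun j hj S₁ => hwlt j hj S₁)
    (fun ω => by rw [hζ]; exact (mul_one _).symm.trans (congrArg _ (if_pos rfl).symm)) (fun S₁ ω => hw S₁ ω)
    (settingOfRecord₁₃ F N θ.toStage13Params p) (θ.rzAt p s) u₁ e₁ (UbgOfRecord₁₃CoP F N θ.toStage13Params p (k + 1) s) V
  rw [key]
  by_cases hσ : 0 < T V ∧ 0 < J V
  · rw [Set.indicator_of_mem (show V ∈ {V | 0 < T V ∧ 0 < J V} from hσ), Pi.one_apply, one_mul, hc V hσ.1 hσ.2,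
      show -(1 / 2 : ℝ) * (2 * Real.log (J V / T V)) = -Real.log (J V / T V) by ring, Real.exp_neg, Real.exp_log (div_pos hσ.2 hσ.1),
      inv_div, div_mul_cancel₀ _ hσ.2.ne']
  · have hT0 : ¬ 0 < T V := fun h => hσ ⟨h, hTJ h⟩
    rw [Set.indicator_of_notMem (show V ∉ {V | 0 < T V ∧ 0 < J V} from hσ), zero_mul, zero_mul]
    exact le_antisymm (not_lt.1 hT0) h0

end Record

/-! ## §3. Next to every `θ`: the switch and the dial at the TOP GENERATION OF EVERY HISTORY LENGTH, rows transferred, and EVERY 𝐓-LAW OF THE RECORD MODULO SUPPORTS -/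

section Inhabited

variable {θ θ' : Stage13HParams F N}
  {R : (p : B12.RunParams) → (n : ℕ) → (ℕ → Set (Site (F.P p.K) 0)) → (ℕ → Set (Site (F.P p.K) 0)) → GaugeField (F.P p.K) n (SU N) → Set (Site (F.P p.K) 0)}

/-- ★ The row `zhLocal` transfers to a parameter whose length-`n` residuals carry a region indicator of the NEW field `V_n` at the top generation `n − 1` and `θ`'s factors below.
[cite: Balaban1988Convergent, (3.1) p.264, (3.2)–(3.4) p.265, p.267] -/
theorem zhLocal_of_repinTop
    (hζ' : ∀ p n Ω Λ j Y ω, (θ'.Zh p n Ω Λ).ζ0 j Y ω = if j + 1 = n then Set.indicator {R p n Ω Λ (ω n).1} (1 : Set (Site (F.P p.K) 0) → ℝ) Y else (θ.Zh p n Ω Λ).ζ0 j Y ω)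
    (hloc : ∀ p n Ω Λ, (θ.Zh p n Ω Λ).LocalLaws) : ∀ p n Ω Λ, (θ'.Zh p n Ω Λ).LocalLaws := by
  intro p n Ω Λ
  refine ⟨fun j Y ω ω' hj hj1 => ?_⟩
  rw [hζ', hζ']
  by_cases h : j + 1 = n
  · subst h
    rw [if_pos rfl, if_pos rfl, hj1]
  · rw [if_neg h, if_neg h]
    exact (hloc p n Ω Λ).zeta0_local j Y ω ω' hj hj1

/-- ★ The row `zhLaws` (`ζ0 ≥ 0`) transfers likewise. [cite: Balaban1988Convergent, p.267 (bookkeeping)] -/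
theorem zhLaws_of_repinTop
    (hζ' : ∀ p n Ω Λ j Y ω, (θ'.Zh p n Ω Λ).ζ0 j Y ω = if j + 1 = n then Set.indicator {R p n Ω Λ (ω n).1} (1 : Set (Site (F.P p.K) 0) → ℝ) Y else (θ.Zh p n Ω Λ).ζ0 j Y ω)
    (hlaws : ∀ p n Ω Λ, (θ.Zh p n Ω Λ).Laws) : ∀ p n Ω Λ, (θ'.Zh p n Ω Λ).Laws := by
  intro p n Ω Λ
  refine ⟨fun j Y ω => ?_⟩
  rw [hζ']
  by_cases h : j + 1 = n
  · rw [if_pos h]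
    exact Set.indicator_nonneg (fun _ _ => zero_le_one) Y
  · rw [if_neg h]
    exact (hlaws p n Ω Λ).zeta0_nonneg j Y ω

/-- ★ The guard `ZhUnity` transfers likewise (one region carries the top-generation weight). [cite: Balaban1988Convergent, (3.16)–(3.20) pp.268–269] -/
theorem zhUnity_of_repinTop
    (hζ' : ∀ p n Ω Λ j Y ω, (θ'.Zh p n Ω Λ).ζ0 j Y ω = if j + 1 = n then Set.indicator {R p n Ω Λ (ω n).1} (1 : Set (Site (F.P p.K) 0) → ℝ) Y else (θ.Zh p n Ω Λ).ζ0 j Y ω)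
    (hU : θ.ZhUnity) : θ'.ZhUnity := by
  intro p n Ω Λ j ω
  simp_rw [hζ']
  by_cases h : j + 1 = n
  · simp_rw [if_pos h]
    rw [finsum_eq_single _ (R p n Ω Λ (ω n).1) fun Y hY => Set.indicator_of_notMem (by simpa using hY) _]
    rw [Set.indicator_of_mem (Set.mem_singleton _), Pi.one_apply]
  · simp_rw [if_neg h]
    exact hU p n Ω Λ j ω

/-- ★★★★★ **HEADLINE — EVERY 𝐓-LAW OF THE RECORD HOLDS MODULO SUPPORTS, NEXT TO EVERY `θ`, FOR ANY PRESCRIBED TERMS.**  For every term assignment `u_p` and constants `e_p` there is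
a parameter `θ′` with the SAME `Stage13RParams` data and `Phih` as `θ`, whose residuals agree with `θ`'s at every generation below the top one of each history length, the rows
`zhLocal` ∕ `zhLaws` ∕ `ZhUnity` transferred, such that for every run `p` AND EVERY STEP `k`: IF (i) the old sides `(𝐓ρ_k)(s)` are nonnegative (automatic under the rows
`zetaUnity` ∕ `zetaAbs`), (ii) FOR EVERY CHILD `s` of length `k+1`, a.e. on the support of `χ_{k+1}(s)`, the reference new side `J_p(s)` — `θ`'s OWN new side at `s` with the terms
`(u_p, e_p)` and the generation-`k` residual factor set to `1` — is positive wherever the old side is, and (iii) the 𝐓-image term laws `Sect2.LawsT … k` hold for `u_p` at every child,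
THEN `TLaw₁₃CoPH θ′ p k`.  The residual slot `Zh` is indexed by the history length, so the per-level witnesses (switch on `ζ_k(Ω_{k+1}ᶜ)`, dial on `quad_k`, both reading `V_{k+1}`
only) do not interact.  So, absent a law tying `quad` to the fluctuation variables, what the 𝐓-side of the record asks of a K1⁹ witness at ANY step is a family of SUPPORT conditions
and the term laws — nothing quantitative.  LOCATED, count-neutral; nothing of Bałaban asserted or refuted; K1⁹'s `∃θ` neither advanced nor refuted ((ii), (iii), the 𝐒-laws, the 𝐑-steps
and the consequent's faces are NOT claimed). [cite: Balaban1988Convergent, Thm 1 p.262, remark p.262, (2.18) p.257, (2.20)–(2.23) p.258, (3.2) p.265, p.267, (3.16)–(3.21) pp.268–269, (3.23)–(3.25) p.270, Def. p.279; Balaban1989LargeFieldI, (0.2)–(0.3) p.176] -/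
theorem exists_zh_allSteps_tLaw_of_supports (θ : Stage13HParams F N)
    (u : (p : B12.RunParams) → (M : ℕ) → Sect2.TermValues (F.P p.K) (MatA N) (FluctV N) M) (e : B12.RunParams → ℝ) :
    ∃ θ' : Stage13HParams F N, θ'.toStage13RParams = θ.toStage13RParams ∧ θ'.Phih = θ.Phih ∧
      (∀ p n Ω Λ j Y ω, j + 1 ≠ n → (θ'.Zh p n Ω Λ).ζ0 j Y ω = (θ.Zh p n Ω Λ).ζ0 j Y ω) ∧
      (∀ p n Ω Λ j Λ' ω, j + 1 ≠ n → (θ'.Zh p n Ω Λ).quad j Λ' ω = (θ.Zh p n Ω Λ).quad j Λ' ω) ∧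
      ((∀ p n Ω Λ, (θ.Zh p n Ω Λ).LocalLaws) → ∀ p n Ω Λ, (θ'.Zh p n Ω Λ).LocalLaws) ∧
      ((∀ p n Ω Λ, (θ.Zh p n Ω Λ).Laws) → ∀ p n Ω Λ, (θ'.Zh p n Ω Λ).Laws) ∧
      (θ.ZhUnity → θ'.ZhUnity) ∧
      ∀ (p : B12.RunParams) (k : ℕ),
        (∀ (s : SeqOfRecord F θ.ν θ.τ9.M (gOfRecord₁₃ F N θ.toStage13Params p) p.K (k + 1)) (V : GaugeField (F.P p.K) (k + 1) (SU N)),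
          0 ≤ slotsTOfRecord F N θ.ν θ.τ9 (EOfRecord₁₃ F N θ.toStage13Params) (wOfRecord₉ F N θ.toStage9Params) θ.ppSel p (gOfRecord₁₃ F N θ.toStage13Params p) (k + 1) s V) →
        (∀ s : SeqOfRecord F θ.ν θ.τ9.M (gOfRecord₁₃ F N θ.toStage13Params p) p.K (k + 1),
          ∀ᵐ V ∂fieldMeasure (F.P p.K) (k + 1) (SU N), chiSeqOfRecord F N θ.ν θ.τ9.M (gOfRecord₁₃ F N θ.toStage13Params p) p.K (k + 1) s V ≠ 0 →
            0 < slotsTOfRecord F N θ.ν θ.τ9 (EOfRecord₁₃ F N θ.toStage13Params) (wOfRecord₉ F N θ.toStage9Params) θ.ppSel p (gOfRecord₁₃ F N θ.toStage13Params p) (k + 1) s V →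
            0 < sect2Slot F N (FluctV N) p.K (settingOfRecord₁₃ F N θ.toStage13Params p) (θ.rzAt p s)
              { WtOfRecord₁₃H F N θ p s with ζ := fun j Y ω => if j = k then 1 else (WtOfRecord₁₃H F N θ p s).ζ j Y ω } s (u p θ.τ9.M) (e p)
              (UbgOfRecord₁₃CoP F N θ.toStage13Params p (k + 1) s) V) →
        (∀ s : SeqOfRecord F θ.ν θ.τ9.M (gOfRecord₁₃ F N θ.toStage13Params p) p.K (k + 1),
          Sect2.LawsT (sect2TowerOfRecord F N (FluctV N) p.K (settingOfRecord₁₃ F N θ.toStage13Params p) (θ.rzAt p s) s (u p θ.τ9.M))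
            (settingOfRecord₁₃ F N θ.toStage13Params p).lf (settingOfRecord₁₃ F N θ.toStage13Params p).βc k) →
        TLaw₁₃CoPH F N θ' p k := by
  classical
  -- old side and reference new side (top-generation residual factor set to `1`), per run, step and history
  let T : (p : B12.RunParams) → (k : ℕ) → SeqOfRecord F θ.ν θ.τ9.M (gOfRecord₁₃ F N θ.toStage13Params p) p.K (k + 1) → GaugeField (F.P p.K) (k + 1) (SU N) → ℝ :=
    fun p k s V => slotsTOfRecord F N θ.ν θ.τ9 (EOfRecord₁₃ F N θ.toStage13Params) (wOfRecord₉ F N θ.toStage9Params) θ.ppSel p (gOfRecord₁₃ F N θ.toStage13Params p) (k + 1) s V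
  let J : (p : B12.RunParams) → (k : ℕ) → SeqOfRecord F θ.ν θ.τ9.M (gOfRecord₁₃ F N θ.toStage13Params p) p.K (k + 1) → GaugeField (F.P p.K) (k + 1) (SU N) → ℝ :=
    fun p k s V => sect2Slot F N (FluctV N) p.K (settingOfRecord₁₃ F N θ.toStage13Params p) (θ.rzAt p s)
      { WtOfRecord₁₃H F N θ p s with ζ := fun j Y ω => if j = k then 1 else (WtOfRecord₁₃H F N θ p s).ζ j Y ω } s (u p θ.τ9.M) (e p)
      (UbgOfRecord₁₃CoP F N θ.toStage13Params p (k + 1) s) V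
  -- the switch set and the dial per run, history length `n = k+1` and history `(Ω, Λ)` (nothing at length `0`)
  let G : (p : B12.RunParams) → (n : ℕ) → (ℕ → Set (Site (F.P p.K) 0)) → (ℕ → Set (Site (F.P p.K) 0)) → Set (GaugeField (F.P p.K) n (SU N)) := fun p n Ω Λ =>
    match n with
    | 0 => ∅
    | k + 1 => {V | ∃ s : SeqOfRecord F θ.ν θ.τ9.M (gOfRecord₁₃ F N θ.toStage13Params p) p.K (k + 1), s.Ω = Ω ∧ s.Λ = Λ ∧ 0 < T p k s V ∧ 0 < J p k s V}
  let c : (p : B12.RunParams) → (n : ℕ) → (ℕ → Set (Site (F.P p.K) 0)) → (ℕ → Set (Site (F.P p.K) 0)) → GaugeField (F.P p.K) n (SU N) → ℝ := fun p n Ω Λ =>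
    match n with
    | 0 => fun _ => 0
    | k + 1 => fun V => if h : ∃ s : SeqOfRecord F θ.ν θ.τ9.M (gOfRecord₁₃ F N θ.toStage13Params p) p.K (k + 1), s.Ω = Ω ∧ s.Λ = Λ then
        2 * Real.log (J p k h.choose V / T p k h.choose V) else 0
  let Yo : (p : B12.RunParams) → ℕ → (ℕ → Set (Site (F.P p.K) 0)) → Set (Site (F.P p.K) 0) := fun p n Ω => if (Ω n)ᶜ = (∅ : Set (Site (F.P p.K) 0)) then Set.univ else ∅
  let R : (p : B12.RunParams) → (n : ℕ) → (ℕ → Set (Site (F.P p.K) 0)) → (ℕ → Set (Site (F.P p.K) 0)) → GaugeField (F.P p.K) n (SU N) → Set (Site (F.P p.K) 0) :=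
    fun p n Ω Λ V => if V ∈ G p n Ω Λ then (Ω n)ᶜ else Yo p n Ω
  have hYo : ∀ p n (Ω : ℕ → Set (Site (F.P p.K) 0)), (Ω n)ᶜ ≠ Yo p n Ω := fun p n Ω h => by
    by_cases he : (Ω n)ᶜ = (∅ : Set (Site (F.P p.K) 0))
    · have h' : (Ω n)ᶜ = Set.univ := by rw [h]; exact if_pos he
      exact Set.empty_ne_univ (he.symm.trans h')
    · exact he (h.trans (if_neg he))
  -- the re-pinned residual: switch and dial at the top generation `j = n − 1` of every history length `n`
  let Zh' : (p : B12.RunParams) → ℕ → (ℕ → Set (Site (F.P p.K) 0)) → (ℕ → Set (Site (F.P p.K) 0)) → TkResidualW F N (FluctV N) p.K := fun p n Ω Λ =>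
    ⟨fun j Y ω => if j + 1 = n then Set.indicator {R p n Ω Λ (ω n).1} (1 : Set (Site (F.P p.K) 0) → ℝ) Y else (θ.Zh p n Ω Λ).ζ0 j Y ω,
      fun j Λ' ω => if j + 1 = n then (θ.Zh p n Ω Λ).quad j Λ' ω + c p n Ω Λ (ω n).1 else (θ.Zh p n Ω Λ).quad j Λ' ω⟩
  let θ' : Stage13HParams F N := { θ with Zh := Zh' }
  have hζ' : ∀ p n Ω Λ j Y ω, (θ'.Zh p n Ω Λ).ζ0 j Y ω =
      if j + 1 = n then Set.indicator {R p n Ω Λ (ω n).1} (1 : Set (Site (F.P p.K) 0) → ℝ) Y else (θ.Zh p n Ω Λ).ζ0 j Y ω := fun _ _ _ _ _ _ _ => rfl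
  have hq' : ∀ p n Ω Λ j Λ' ω, (θ'.Zh p n Ω Λ).quad j Λ' ω =
      if j + 1 = n then (θ.Zh p n Ω Λ).quad j Λ' ω + c p n Ω Λ (ω n).1 else (θ.Zh p n Ω Λ).quad j Λ' ω := fun _ _ _ _ _ _ _ => rfl
  refine ⟨θ', rfl, rfl, fun p n Ω Λ j Y ω hj => by rw [hζ', if_neg hj], fun p n Ω Λ j Λ' ω hj => by rw [hq', if_neg hj], zhLocal_of_repinTop hζ',
    zhLaws_of_repinTop hζ', zhUnity_of_repinTop hζ', fun p k hT0 hJ hlaw => ?_⟩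
  refine (tLaw₁₃CoPH_iff F N θ' p k).2 ⟨fun _ => u p θ.τ9.M, fun _ => e p, Sect2.universalE_const _, fun s => ⟨hlaw s, Or.inr ?_⟩⟩
  -- at the child `s` of length `k+1`
  have hne : ∀ j, j < k → j + 1 ≠ k + 1 := fun j hj h => (Nat.ne_of_lt hj) (Nat.succ_injective h)
  have hex : ∃ s₀ : SeqOfRecord F θ.ν θ.τ9.M (gOfRecord₁₃ F N θ.toStage13Params p) p.K (k + 1), s₀.Ω = s.Ω ∧ s₀.Λ = s.Λ := ⟨s, rfl, rfl⟩
  have hch : hex.choose = s := Seq.ext' hex.choose_spec.1 hex.choose_spec.2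
  have hG : ∀ V, V ∈ G p (k + 1) s.Ω s.Λ ↔ 0 < T p k s V ∧ 0 < J p k s V := fun V => by
    show (∃ s₀ : SeqOfRecord F θ.ν θ.τ9.M (gOfRecord₁₃ F N θ.toStage13Params p) p.K (k + 1), s₀.Ω = s.Ω ∧ s₀.Λ = s.Λ ∧ 0 < T p k s₀ V ∧ 0 < J p k s₀ V) ↔ _
    exact ⟨fun ⟨s₀, hsΩ, hsΛ, hs⟩ => by rw [Seq.ext' hsΩ hsΛ] at hs; exact hs, fun h => ⟨s, rfl, rfl, h⟩⟩
  have hζlt : ∀ j, j < k → (WtOfRecord₁₃H F N θ' p s).ζ j (s.Ω (j + 1))ᶜ = (WtOfRecord₁₃H F N θ p s).ζ j (s.Ω (j + 1))ᶜ := fun j hj => by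
    funext ω
    rw [WtOfRecord₁₃H_ζ_eq_ζ0, WtOfRecord₁₃H_ζ_eq_ζ0, hζ', if_neg (hne j hj)]
  have hwlt : ∀ j, j < k → ∀ S₁, (WtOfRecord₁₃H F N θ' p s).w j (s.Λ (j + 1)) ((s.Λ (j + 1))ᶜ ∩ s.Ω (j + 1)) S₁ =
      (WtOfRecord₁₃H F N θ p s).w j (s.Λ (j + 1)) ((s.Λ (j + 1))ᶜ ∩ s.Ω (j + 1)) S₁ := fun j hj S₁ => by
    funext ω
    show chiAW F N (FluctV N) θ.ν θ.A₁ p (gOfRecord₁₃ F N θ.toStage13Params p) j ((s.Λ (j + 1))ᶜ ∩ s.Ω (j + 1)) S₁ ω * Real.exp (-(1 / 2 : ℝ) * (θ'.Zh p (k + 1) s.Ω s.Λ).quad j (s.Λ (j + 1)) ω) =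
      chiAW F N (FluctV N) θ.ν θ.A₁ p (gOfRecord₁₃ F N θ.toStage13Params p) j ((s.Λ (j + 1))ᶜ ∩ s.Ω (j + 1)) S₁ ω * Real.exp (-(1 / 2 : ℝ) * (θ.Zh p (k + 1) s.Ω s.Λ).quad j (s.Λ (j + 1)) ω)
    rw [hq', if_neg (hne j hj)]
  have hζ : ∀ ω, (WtOfRecord₁₃H F N θ' p s).ζ k (s.Ω (k + 1))ᶜ ω = Set.indicator {V | 0 < T p k s V ∧ 0 < J p k s V} (1 : GaugeField (F.P p.K) (k + 1) (SU N) → ℝ) (ω (k + 1)).1 := by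
    intro ω
    rw [WtOfRecord₁₃H_ζ_eq_ζ0, hζ', if_pos rfl]
    by_cases hV : 0 < T p k s (ω (k + 1)).1 ∧ 0 < J p k s (ω (k + 1)).1
    · have hRV : R p (k + 1) s.Ω s.Λ (ω (k + 1)).1 = (s.Ω (k + 1))ᶜ := if_pos ((hG _).2 hV)
      rw [hRV, Set.indicator_of_mem (Set.mem_singleton _), Set.indicator_of_mem (show (ω (k + 1)).1 ∈ {V | 0 < T p k s V ∧ 0 < J p k s V} from hV),
        Pi.one_apply, Pi.one_apply]
    · have hRV : R p (k + 1) s.Ω s.Λ (ω (k + 1)).1 = Yo p (k + 1) s.Ω := if_neg (fun h => hV ((hG _).1 h))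
      rw [hRV, Set.indicator_of_notMem (fun h => hYo p (k + 1) s.Ω (Set.mem_singleton_iff.1 h)),
        Set.indicator_of_notMem (show (ω (k + 1)).1 ∉ {V | 0 < T p k s V ∧ 0 < J p k s V} from hV)]
  have hw : ∀ S₁ ω, (WtOfRecord₁₃H F N θ' p s).w k (s.Λ (k + 1)) ((s.Λ (k + 1))ᶜ ∩ s.Ω (k + 1)) S₁ ω =
      Real.exp (-(1 / 2 : ℝ) * c p (k + 1) s.Ω s.Λ (ω (k + 1)).1) * (WtOfRecord₁₃H F N θ p s).w k (s.Λ (k + 1)) ((s.Λ (k + 1))ᶜ ∩ s.Ω (k + 1)) S₁ ω := by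
    intro S₁ ω
    show chiAW F N (FluctV N) θ.ν θ.A₁ p (gOfRecord₁₃ F N θ.toStage13Params p) k ((s.Λ (k + 1))ᶜ ∩ s.Ω (k + 1)) S₁ ω * Real.exp (-(1 / 2 : ℝ) * (θ'.Zh p (k + 1) s.Ω s.Λ).quad k (s.Λ (k + 1)) ω) =
      Real.exp (-(1 / 2 : ℝ) * c p (k + 1) s.Ω s.Λ (ω (k + 1)).1) *
        (chiAW F N (FluctV N) θ.ν θ.A₁ p (gOfRecord₁₃ F N θ.toStage13Params p) k ((s.Λ (k + 1))ᶜ ∩ s.Ω (k + 1)) S₁ ω * Real.exp (-(1 / 2 : ℝ) * (θ.Zh p (k + 1) s.Ω s.Λ).quad k (s.Λ (k + 1)) ω))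
    rw [hq', if_pos rfl, mul_add, Real.exp_add]
    ring
  have hc : ∀ V, 0 < T p k s V → 0 < J p k s V → c p (k + 1) s.Ω s.Λ V = 2 * Real.log (J p k s V / T p k s V) := fun V _ _ => by
    show (if h : ∃ s₀ : SeqOfRecord F θ.ν θ.τ9.M (gOfRecord₁₃ F N θ.toStage13Params p) p.K (k + 1), s₀.Ω = s.Ω ∧ s₀.Λ = s.Λ then
      2 * Real.log (J p k h.choose V / T p k h.choose V) else 0) = _
    rw [dif_pos hex, hch]
  filter_upwards [hJ s] with V hV hχ
  exact slotsT_succ_eq_sect2Slot_of_switch_dial θ p s (u p θ.τ9.M) (e p) (WtOfRecord₁₃H F N θ' p s) (c p (k + 1) s.Ω s.Λ) hζlt hwlt hζ hw hc V (hT0 s V)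
    (hV hχ)

end Inhabited

/-! ## §4. Inside K1⁹'s hypothesis class: every 𝐓-law from the support conditions and the term laws alone -/

section Hypotheses

/-- ★★★★★ **K1⁹'s HYPOTHESIS LIST DOES NOT EXCLUDE IT, AT ANY STEP**: from ANY `θ` carrying K1⁹'s four hypothesis-side conjuncts there is a `θ′` CARRYING THE SAME FOUR (same
`Stage13RParams` data and `Phih`; residuals agreeing with `θ`'s below the top generation of every history length) such that for every run `p` and EVERY step `k` the per-child support
conditions (a.e. on the support of `χ_{k+1}(s)`: `0 < (𝐓ρ_k)(s) → 0 < J_p(s)`) and the 𝐓-image term laws `Sect2.LawsT … k` for the prescribed terms ALONE give `TLaw₁₃CoPH θ′ p k` (the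
nonnegativity of the old sides comes from the rows `zetaUnity` ∕ `zetaAbs`).  LOCATED, count-neutral; nothing of Bałaban asserted or refuted; K1⁹'s `∃θ` neither advanced nor refuted; N11
NOT discharged. [cite: Balaban1988Convergent, Thm 1 p.262, remark p.262, (2.18) p.257, (2.21)–(2.23) p.258, (3.2)–(3.9) pp.265–266, (3.16)–(3.21) pp.268–269, (3.23)–(3.25) p.270, Def. p.279] -/
theorem exists_zh_allSteps_tLaw_of_supports_of_hypotheses (θ : Stage13HParams F N) (hP : θ.Provisos₁₃SepCoPH F N) (hU : θ.ZhUnity)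
    (hS : θ.SlotsNondegenerate₁₃ F N) (hA : θ.Admissible F N)
    (u : (p : B12.RunParams) → (M : ℕ) → Sect2.TermValues (F.P p.K) (MatA N) (FluctV N) M) (e : B12.RunParams → ℝ) :
    ∃ θ' : Stage13HParams F N, θ'.toStage13RParams = θ.toStage13RParams ∧ θ'.Phih = θ.Phih ∧
      (∀ p n Ω Λ j Y ω, j + 1 ≠ n → (θ'.Zh p n Ω Λ).ζ0 j Y ω = (θ.Zh p n Ω Λ).ζ0 j Y ω) ∧
      (∀ p n Ω Λ j Λ' ω, j + 1 ≠ n → (θ'.Zh p n Ω Λ).quad j Λ' ω = (θ.Zh p n Ω Λ).quad j Λ' ω) ∧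
      θ'.Provisos₁₃SepCoPH F N ∧ (θ'.ZhUnity ∧ θ'.SlotsNondegenerate₁₃ F N) ∧ θ'.Admissible F N ∧
      ∀ (p : B12.RunParams) (k : ℕ),
        (∀ s : SeqOfRecord F θ.ν θ.τ9.M (gOfRecord₁₃ F N θ.toStage13Params p) p.K (k + 1),
          ∀ᵐ V ∂fieldMeasure (F.P p.K) (k + 1) (SU N), chiSeqOfRecord F N θ.ν θ.τ9.M (gOfRecord₁₃ F N θ.toStage13Params p) p.K (k + 1) s V ≠ 0 →
            0 < slotsTOfRecord F N θ.ν θ.τ9 (EOfRecord₁₃ F N θ.toStage13Params) (wOfRecord₉ F N θ.toStage9Params) θ.ppSel p (gOfRecord₁₃ F N θ.toStage13Params p) (k + 1) s V →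
            0 < sect2Slot F N (FluctV N) p.K (settingOfRecord₁₃ F N θ.toStage13Params p) (θ.rzAt p s)
              { WtOfRecord₁₃H F N θ p s with ζ := fun j Y ω => if j = k then 1 else (WtOfRecord₁₃H F N θ p s).ζ j Y ω } s (u p θ.τ9.M) (e p)
              (UbgOfRecord₁₃CoP F N θ.toStage13Params p (k + 1) s) V) →
        (∀ s : SeqOfRecord F θ.ν θ.τ9.M (gOfRecord₁₃ F N θ.toStage13Params p) p.K (k + 1),
          Sect2.LawsT (sect2TowerOfRecord F N (FluctV N) p.K (settingOfRecord₁₃ F N θ.toStage13Params p) (θ.rzAt p s) s (u p θ.τ9.M))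
            (settingOfRecord₁₃ F N θ.toStage13Params p).lf (settingOfRecord₁₃ F N θ.toStage13Params p).βc k) →
        TLaw₁₃CoPH F N θ' p k := by
  obtain ⟨θ', h1, h2, hζoff, hqoff, hloc, hlaws, hun, htl⟩ := exists_zh_allSteps_tLaw_of_supports θ u e
  exact ⟨θ', h1, h2, hζoff, hqoff, provisos₁₃SepCoPH_of_sameR h1 hP (hlaws hP.zhLaws) (hloc hP.zhLocal), ⟨hun hU, slotsNondegenerate₁₃_of_sameR h1 hS⟩,
    admissible_of_sameR h1 hA, fun p k hJ hlaw => htl p k (fun s V => slotsTOfRecord_nonneg_of_provisos₁₃CoPH θ p hP.toCore s V) hJ hlaw⟩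

end Hypotheses




end Summit.QuantumFields.YangMills.Theorems.BalabanUVNodesN11AllStepsQuadSlot

end
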